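import Literature.AlgebraicGeometry.Motives.HodgeStructureOfCMType
import Literature.AlgebraicGeometry.ComplexMultiplication.ShimuraIsogenyBetti
import Literature.AlgebraicGeometry.HodgeTheory.BettiUniverseCMTypes
import Literature.AlgebraicGeometry.Motives.GeometricVHSPolarizedTransport
import Literature.AlgebraicGeometry.Motives.WeilTypeCMProofs
import Literature.AlgebraicGeometry.Motives.MumfordTateGroupTransport
import HarnessLib

/-!
# The CM-type Hodge structure `V¹_{(K,Φ)}` IS `H¹(A(ℂ); ℚ)` of every realisation of `(K; Φ)`

Family `hodge`, layer `Literature/AlgebraicGeometry/HodgeTheory`, sub-namespace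
`Literature.AlgebraicGeometry.HodgeTheory.CMBettiModel`.  Theorems only; no definition, no named fact.

For a CM type `(K; Φ)` and a realisation `(A, ι, θ)` of it read on `H¹`
(`ComplexMultiplication.IsCMTypeRealisation Φ A ι θ`: `A/ℂ` an abelian variety, `θ = ι^*` on `𝓞_K`,
`dim H¹ = [K:ℚ]`, one-dimensional `σ`-eigenlines of type `(1,0)` for `σ ∈ Φ`, `(0,1)` for `σ ∉ Φ`; Shimura 1998
§5.2 / §6.2) the rational weight-one Hodge structure of the CM type, `HodgeStructure.ofCMType Φ` on `V = K`
(`Motives/HodgeStructureOfCMType`: `V^{1,0} = ⊕_{σ ∈ Φ} ℂ_σ = coordSubspace K Φ`; Green–Griffiths–Kerr §V.B,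
Deligne LNM 900 Example 3.7), is ISOMORPHIC, `K`-equivariantly, to `BettiUniverse.hodge hHD hA 1` on `H¹(A(ℂ); ℚ)`
with its rational CM action `BettiUniverse.cmAction θ hθ` (`HodgeTheory/BettiUniverseCMAction`) — Green–Griffiths–Kerr
§V.B: "`V¹_{(K,Σ)} = H¹(A^{(K,Σ)}_𝔞)` as `ℚ`-Hodge structures, independently of `𝔞`".  In the tree's idiom for
isomorphic Hodge structures (`Motives.HodgeStructure.comapEquiv`):

* `exists_equivariant_equiv` — linear algebra of a FIELD `K` acting `ℚ`-linearly on `V`: orbit maps of non-zero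
  vectors are injective, so if `dim_ℚ V = [K:ℚ]` there is a `K`-equivariant `ℚ`-linear isomorphism `K ≃ V`;
* `map_iInf_eigenspace_lmul_le`, `map_coordSubspace_singleton_eq` — `e_ℂ` carries the line `ℂ_σ ⊆ K ⊗ ℂ` ONTO the
  `σ`-eigenspace `H¹(A)_σ`;
* `coordSubspace_cmType_eq_iSup` (`⊕_{σ ∈ Φ} ℂ_σ` is the sum of the lines `ℂ_σ`, `σ ∈ Φ`), `hodge_F_one_eq_iSup`
  (`F¹ H¹(A) = ⊕_{σ ∈ Φ} H¹(A)_σ`, from `BettiUniverse.eigenPiece_one_zero_eq_eigenLine` / `_eq_bot` and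
  `EndAction.iSup_eigenPiece_holds`), `map_coordSubspace_cmType_eq` (`e_ℂ V^{1,0} = F¹ H¹(A)`);
* `ofCMType_eq_comapEquiv` — **rigidity**: EVERY `K`-equivariant `ℚ`-linear isomorphism `e : K ≃ H¹(A(ℂ); ℚ)` is an
  isomorphism of Hodge structures, `HodgeStructure.ofCMType Φ = (BettiUniverse.hodge hHD hA 1).comapEquiv e`;
  `exists_ofCMType_eq_comapEquiv` — such an `e` exists;
* `mem_mumfordTateGroup_ofCMType_iff`, `mem_hodgeGroup_ofCMType_iff`, `mumfordTateLieAlgebra_ofCMType_eq`,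
  `mtRank_ofCMType_eq` — consequently the Mumford–Tate and Hodge groups (the tree's `ℚ`-points groups of
  `Motives/HodgeTensor`), the Mumford–Tate Lie algebra and the Mumford–Tate rank of `V¹_{(K,Φ)}` and of `H¹(A(ℂ); ℚ)`
  are CONJUGATE by `e` / EQUAL (`Motives/MumfordTateGroupTransport`, `Motives/MumfordTateRankInvariance`).

Transport of invariants along `e` is then BY NAME (`HodgeStructure.comapEquiv_hodgeClasses`, `comapEquiv_piece`,
`IsPolarizable.comapEquiv`, `mumfordTateLieAlgebra_comapEquiv`, `mtRank_comapEquiv`, `tensorPower_comapEquiv`, …).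
`hHD : exists_isReal_hodgeModel`, `hI : hodgePQ_independent_of_hodgeModel` are the LIGHT hypotheses of
`BettiUniverseCMAction` (both theorems of the tree).  Summit-side companion over the COR-CM carrier
`Summit.HodgeConjecture.CorCM.CMTypeHodge.hodge`: `Summits/HodgeConjecture/CorCM/Model/CMBettiModel.lean` (same
argument; this file is the Literature form every Literature consumer can import).

## References

* [GreenGriffithsKerr2012] M. Green, P. Griffiths, M. Kerr, Mumford–Tate Groups and Domains, Ann. of Math. Stud. 183
  (2012), §V.B ("`V¹_{(K,Σ)} = H¹(A^{(K,Σ)}_𝔞)` as `ℚ`-Hodge structures"), §V.C.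
* [Deligne1982HodgeCycles] P. Deligne, Hodge cycles on abelian varieties, LNM 900 (1982), Example 3.7, §4–§5.
* [Shimura1998] G. Shimura, Abelian Varieties with Complex Multiplication and Modular Functions (1998), §3.2
  pp. 20–22, §5.2 pp. 36–37, §6.2 Thm. 3.
-/

noncomputable section

open scoped TensorProduct
open NumberField CategoryTheory Module

namespace Literature.AlgebraicGeometry.HodgeTheory

namespace CMBettiModel

open Literature.AlgebraicGeometry.Motives (CMType HodgeStructure AbelianVariety bettiCohomology IsSmoothProjective)
open Literature.AlgebraicGeometry.Motives.HodgeStructure (coordSubspace ofCMType endActionOfCMType)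
open Literature.AlgebraicGeometry.HodgeTheory.BettiUniverse (cmAction cmEndAction cmEndAction_ι IsInducedOnIntegers)
open Literature.AlgebraicGeometry.ComplexMultiplication (IsCMTypeRealisation)

/-! ### A field acting `ℚ`-linearly: orbit maps and equivariant isomorphisms -/

section Orbit

variable {K : Type*} [Field K] [Algebra ℚ K] {V : Type*} [AddCommGroup V] [Module ℚ V]
  (ι : K →ₐ[ℚ] Module.End ℚ V)

/-- The orbit map `k ↦ k ⋅ v` of a non-zero vector under a `ℚ`-algebra action of a FIELD is injective
(`k ⋅ v = 0`, `k ≠ 0` ⇒ `v = k⁻¹ ⋅ k ⋅ v = 0`). [folklore] -/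
private theorem orbit_injective {v : V} (hv : v ≠ 0) : Function.Injective fun k : K => ι k v := by
  intro k₁ k₂ h12
  by_contra hne
  have hk : k₁ - k₂ ≠ 0 := sub_ne_zero.2 hne
  have hsub : ι (k₁ - k₂) v = 0 := by
    rw [map_sub, LinearMap.sub_apply]
    exact sub_eq_zero.2 h12
  apply hv
  calc v = ι ((k₁ - k₂)⁻¹ * (k₁ - k₂)) v := by rw [inv_mul_cancel₀ hk, map_one, Module.End.one_apply]
    _ = ι (k₁ - k₂)⁻¹ (ι (k₁ - k₂) v) := by rw [map_mul, Module.End.mul_apply]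
    _ = 0 := by rw [hsub, map_zero]

/-- **A `ℚ`-space of dimension `[K:ℚ]` with a `K`-action is a `K`-line**: there is a `K`-EQUIVARIANT `ℚ`-linear
isomorphism `e : K ≃ V`, `e (k x) = k ⋅ e x` — the orbit map of any non-zero vector (Shimura 1998 §3.2: the
rational representation of `K` on `H¹(A, ℚ)` is the regular one; Deligne, Example 3.7: "from the choice of a
nonzero element of `H₁(A, ℚ)`, we obtain an isomorphism `H₁(A, ℚ) ≃ E`").
[cite: Deligne1982HodgeCycles, Example 3.7] [cite: Shimura1998, §3.2, pp. 20–22] -/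
theorem exists_equivariant_equiv [FiniteDimensional ℚ K] [FiniteDimensional ℚ V]
    (hrk : Module.finrank ℚ V = Module.finrank ℚ K) :
    ∃ e : K ≃ₗ[ℚ] V, ∀ k x, e (k * x) = ι k (e x) := by
  have hpos : 0 < Module.finrank ℚ V := by rw [hrk]; exact Module.finrank_pos
  obtain ⟨v, hv⟩ := Module.finrank_pos_iff_exists_ne_zero.1 hpos
  let f : K →ₗ[ℚ] V := (LinearMap.applyₗ v).comp ι.toLinearMap
  have hf : ∀ k, f k = ι k v := fun k => rfl
  have hinj : Function.Injective f := orbit_injective ι hv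
  refine ⟨f.linearEquivOfInjective hinj hrk.symm, fun k x => ?_⟩
  rw [LinearMap.linearEquivOfInjective_apply, LinearMap.linearEquivOfInjective_apply, hf, hf, map_mul,
    Module.End.mul_apply]

/-- The complexification of a `K`-equivariant map is `K`-equivariant: `e_ℂ ((k ⋅)_ℂ t) = (k ⋅)_ℂ (e_ℂ t)`.
[folklore] -/
private theorem baseChange_equivariant (e : K ≃ₗ[ℚ] V) (he : ∀ k x, e (k * x) = ι k (e x)) (k : K) (t : ℂ ⊗[ℚ] K) :
    e.toLinearMap.baseChange ℂ ((Algebra.lmul ℚ K k : Module.End ℚ K).baseChange ℂ t) =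
      (ι k).baseChange ℂ (e.toLinearMap.baseChange ℂ t) := by
  have hlin : e.toLinearMap ∘ₗ (Algebra.lmul ℚ K k : Module.End ℚ K) = ι k ∘ₗ e.toLinearMap :=
    LinearMap.ext fun x => by simpa using he k x
  have h := congrArg (fun f : K →ₗ[ℚ] V => f.baseChange ℂ t) hlin
  simpa only [LinearMap.baseChange_comp, LinearMap.comp_apply] using h

/-- `e_ℂ` carries the joint `σ`-eigenspace of multiplication INTO the joint `σ`-eigenspace of the action, for
every `K`-equivariant `e`. [cite: Deligne1982HodgeCycles, §4] -/
theorem map_iInf_eigenspace_lmul_le (e : K ≃ₗ[ℚ] V) (he : ∀ k x, e (k * x) = ι k (e x)) (σ : K →+* ℂ) :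
    (⨅ k : K, Module.End.eigenspace ((Algebra.lmul ℚ K k : Module.End ℚ K).baseChange ℂ) (σ k)).map
        (e.toLinearMap.baseChange ℂ) ≤
      ⨅ k : K, Module.End.eigenspace ((ι k).baseChange ℂ) (σ k) := by
  rintro _ ⟨t, ht, rfl⟩
  rw [Submodule.mem_iInf]
  intro k
  rw [Module.End.mem_eigenspace_iff, ← baseChange_equivariant ι e he k t]
  have hk := (Submodule.mem_iInf _).1 ht k
  rw [Module.End.mem_eigenspace_iff] at hk
  rw [hk, map_smul]

end Orbit

/-! ### `⊕_{σ ∈ Φ} ℂ_σ` as a sum of lines -/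

section Coordinates

variable {K : Type} [Field K] [NumberField K] (Φ : CMType K)

/-- **`⊕_{σ ∈ Φ} ℂ_σ = Σ_{σ ∈ Φ} ℂ_σ`**: the coordinate subspace of the CM type is the sum of the coordinate lines
(`V^{1,0} = ⊕_σ V^{1,0}_σ`, `EndAction.iSup_eigenPiece_holds`, with `V^{1,0}_σ = ℂ_σ` on `Φ` and `0` off `Φ`,
`eigenPiece_one_zero_endActionOfCMType`). [cite: GreenGriffithsKerr2012, §V.B–V.C] -/
theorem coordSubspace_cmType_eq_iSup : coordSubspace K Φ.1 = ⨆ σ ∈ Φ.1, coordSubspace K {σ} := by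
  rw [← HodgeStructure.piece_one_zero_ofCMType Φ,
    ← HodgeStructure.EndAction.iSup_eigenPiece_holds (endActionOfCMType Φ) 1 0]
  apply le_antisymm
  · refine iSup_le fun σ => ?_
    rw [HodgeStructure.eigenPiece_one_zero_endActionOfCMType]
    by_cases hσ : σ ∈ Φ.1
    · rw [Set.inter_eq_right.2 (Set.singleton_subset_iff.2 hσ)]
      exact le_iSup₂_of_le σ hσ le_rfl
    · rw [Set.inter_singleton_eq_empty.2 hσ]
      intro x hx
      have hx0 : x = 0 := (HodgeStructure.RealMult.embCoords K).injective (by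
        funext τ
        rw [map_zero, Pi.zero_apply]
        exact (HodgeStructure.mem_coordSubspace_iff.1 hx) τ (Set.notMem_empty τ))
      rw [hx0]
      exact Submodule.zero_mem _
  · refine iSup₂_le fun σ hσ => ?_
    rw [← Set.inter_eq_right.2 (Set.singleton_subset_iff.2 hσ),
      ← HodgeStructure.eigenPiece_one_zero_endActionOfCMType]
    exact le_iSup (fun τ => (endActionOfCMType Φ).eigenPiece τ 1 0) σ

end Coordinates

/-! ### Rigidity: every equivariant isomorphism is an isomorphism of Hodge structures -/

section Rigidity

variable {K : Type} [Field K] [NumberField K] {Φ : CMType K} {A : AbelianVariety ℂ} {ι : 𝓞 K →+* End A}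
  {θ : K →+* Module.End ℂ (complexBetti A.X 1)}

/-- **`e_ℂ (ℂ_σ) = H¹(A)_σ`**: a `K`-equivariant `ℚ`-isomorphism `e : K ≃ H¹(A(ℂ); ℚ)` carries the coordinate line
`ℂ_σ ⊆ K ⊗ ℂ` ONTO the `σ`-eigenspace of the complexified rational CM action (into: equivariance; onto: both are
lines — `finrank_coordSubspace`, `BettiUniverse.finrank_eigenLine_eq_one`).
[cite: Deligne1982HodgeCycles, Example 3.7 and §4] [cite: Shimura1998, §3.2, pp. 20–22] -/
theorem map_coordSubspace_singleton_eq (h : IsCMTypeRealisation Φ A ι θ) (hHD : exists_isReal_hodgeModel)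
    (hI : hodgePQ_independent_of_hodgeModel) (e : K ≃ₗ[ℚ] bettiCohomology A.X 1)
    (he : ∀ k x, e (k * x) = cmAction θ h.isInducedOnIntegers k (e x)) (σ : K →+* ℂ) :
    (coordSubspace K {σ}).map (e.toLinearMap.baseChange ℂ) =
      ⨅ k : K, Module.End.eigenspace
        (((cmEndAction θ h.isInducedOnIntegers hHD hI h.1).ι k).baseChange ℂ) (σ k) := by
  haveI : Module.Finite ℚ (bettiCohomology A.X 1) := BettiUniverse.finite h.1 1
  refine Submodule.eq_of_le_of_finrank_eq ?_ ?_
  · rw [← HodgeStructure.iInf_eigenspace_lmul σ, cmEndAction_ι]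
    exact map_iInf_eigenspace_lmul_le (cmAction θ h.isInducedOnIntegers) e he σ
  · rw [BettiUniverse.finrank_eigenLine_eq_one θ h.isInducedOnIntegers hHD hI h.1 σ (h.2.2.2 σ).1]
    have hm : (coordSubspace K {σ}).map (e.toLinearMap.baseChange ℂ) =
        (coordSubspace K {σ}).map (e.baseChange ℚ ℂ K (bettiCohomology A.X 1)).toLinearMap := rfl
    rw [hm, LinearEquiv.finrank_map_eq, HodgeStructure.finrank_coordSubspace, Set.ncard_singleton]

/-- **`F¹ H¹(A) = ⊕_{σ ∈ Φ} H¹(A)_σ`**: the last step of the Hodge filtration of `H¹(A(ℂ); ℚ)` (= `H^{1,0}`, as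
`F⁰` is everything) is the sum over the CM type of the `σ`-eigenspaces of the rational CM action — the CM-type
clauses `σ ∈ Φ ⇒ H^{1,0}_σ = H¹_σ`, `σ ∉ Φ ⇒ H^{1,0}_σ = 0` (`BettiUniverse.eigenPiece_one_zero_eq_eigenLine`,
`eigenPiece_one_zero_eq_bot`) summed by `V^{1,0} = ⊕_σ V^{1,0}_σ` (`EndAction.iSup_eigenPiece_holds`).
[cite: Shimura1998, §5.2, pp. 36–37] [cite: Deligne1982HodgeCycles, §5] -/
theorem hodge_F_one_eq_iSup (h : IsCMTypeRealisation Φ A ι θ) (hHD : exists_isReal_hodgeModel)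
    (hI : hodgePQ_independent_of_hodgeModel) :
    (BettiUniverse.hodge hHD h.1 1).F 1 =
      ⨆ σ ∈ Φ.1, ⨅ k : K, Module.End.eigenspace
        (((cmEndAction θ h.isInducedOnIntegers hHD hI h.1).ι k).baseChange ℂ) (σ k) := by
  set H := BettiUniverse.hodge hHD h.1 1 with hH
  have hF0 : H.F 0 = ⊤ := HodgeModel.ratF_of_nonpos _ h.1 1 le_rfl
  have hF1 : H.F 1 = H.piece 1 0 := by
    rw [HodgeStructure.piece_of_add_eq H (by norm_num), hF0, HodgeStructure.complexConj_top, inf_top_eq]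
  rw [hF1, ← HodgeStructure.EndAction.iSup_eigenPiece_holds (cmEndAction θ h.isInducedOnIntegers hHD hI h.1) 1 0]
  refine le_antisymm (iSup_le fun σ => ?_) (iSup₂_le fun σ hσ => ?_)
  · by_cases hσ : σ ∈ Φ.1
    · rw [BettiUniverse.eigenPiece_one_zero_eq_eigenLine θ h.isInducedOnIntegers hHD hI h.1 σ
        ((h.2.2.2 σ).2.1 hσ)]
      exact le_iSup₂_of_le σ hσ le_rfl
    · rw [BettiUniverse.eigenPiece_one_zero_eq_bot θ h.isInducedOnIntegers hHD hI h.1 σ ((h.2.2.2 σ).2.2 hσ)]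
      exact bot_le
  · rw [← BettiUniverse.eigenPiece_one_zero_eq_eigenLine θ h.isInducedOnIntegers hHD hI h.1 σ
      ((h.2.2.2 σ).2.1 hσ)]
    exact le_iSup (fun τ => (cmEndAction θ h.isInducedOnIntegers hHD hI h.1).eigenPiece τ 1 0) σ

/-- **`e_ℂ (⊕_{σ ∈ Φ} ℂ_σ) = F¹ H¹(A)`** for every `K`-equivariant `ℚ`-isomorphism `e`.
[cite: GreenGriffithsKerr2012, §V.B] [cite: Deligne1982HodgeCycles, Example 3.7] -/
theorem map_coordSubspace_cmType_eq (h : IsCMTypeRealisation Φ A ι θ) (hHD : exists_isReal_hodgeModel)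
    (hI : hodgePQ_independent_of_hodgeModel) (e : K ≃ₗ[ℚ] bettiCohomology A.X 1)
    (he : ∀ k x, e (k * x) = cmAction θ h.isInducedOnIntegers k (e x)) :
    (coordSubspace K Φ.1).map (e.toLinearMap.baseChange ℂ) = (BettiUniverse.hodge hHD h.1 1).F 1 := by
  rw [hodge_F_one_eq_iSup h hHD hI, coordSubspace_cmType_eq_iSup Φ]
  simp only [Submodule.map_iSup, map_coordSubspace_singleton_eq h hHD hI e he]

/-- **Rigidity (Green–Griffiths–Kerr §V.B, "`V¹_{(K,Σ)} = H¹(A^{(K,Σ)}_𝔞)` as `ℚ`-Hodge structures"): every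
`K`-equivariant `ℚ`-linear isomorphism `e : K ≃ H¹(A(ℂ); ℚ)` is an isomorphism of Hodge structures** from
`HodgeStructure.ofCMType Φ` to `BettiUniverse.hodge hHD hA 1` — in the tree's idiom,
`ofCMType Φ = (BettiUniverse.hodge hHD hA 1).comapEquiv e` (`F^{≤ 0}`: everything on both sides; `F¹`:
`map_coordSubspace_cmType_eq`; `F^{≥ 2} = 0` on both sides).  Deligne: an `E`-Hodge structure of weight one with
`dim_E V = 1` is determined by its CM type. [cite: GreenGriffithsKerr2012, §V.B]
[cite: Deligne1982HodgeCycles, Example 3.7 and §5] [cite: Shimura1998, §5.2, pp. 36–37] -/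
theorem ofCMType_eq_comapEquiv (h : IsCMTypeRealisation Φ A ι θ) (hHD : exists_isReal_hodgeModel)
    (hI : hodgePQ_independent_of_hodgeModel) (e : K ≃ₗ[ℚ] bettiCohomology A.X 1)
    (he : ∀ k x, e (k * x) = cmAction θ h.isInducedOnIntegers k (e x)) :
    ofCMType Φ = (BettiUniverse.hodge hHD h.1 1).comapEquiv e := by
  have hinj : Function.Injective (e.toLinearMap.baseChange ℂ) := HodgeStructure.baseChange_injective_of_equiv e
  apply HodgeStructure.ext
  funext p
  rw [HodgeStructure.comapEquiv_F, HodgeStructure.ofCMType_F]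
  by_cases hp : p ≤ 0
  · rw [HodgeStructure.twoStepFiltration_of_le_zero _ hp, BettiUniverse.hodge_F,
      HodgeModel.ratF_of_nonpos _ h.1 1 hp, Submodule.comap_top]
  by_cases hp1 : 1 < p
  · rw [HodgeStructure.twoStepFiltration_of_lt _ (by omega) hp1, BettiUniverse.hodge_F,
      HodgeModel.ratF_eq_bot _ h.1 1 (by exact_mod_cast hp1), Submodule.comap_bot]
    exact (LinearMap.ker_eq_bot.2 hinj).symm
  obtain rfl : p = 1 := by omega
  rw [HodgeStructure.twoStepFiltration_of_pos_of_le _ one_pos le_rfl, ← map_coordSubspace_cmType_eq h hHD hI e he,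
    Submodule.comap_map_eq_of_injective hinj]

/-- **`V¹_{(K,Φ)} ≅ H¹(A(ℂ); ℚ)` for every realisation `(A, ι, θ)` of `(K; Φ)`**: there is a `K`-equivariant
`ℚ`-linear isomorphism `e : K ≃ H¹(A(ℂ); ℚ)` which is an isomorphism of Hodge structures
`HodgeStructure.ofCMType Φ ≅ BettiUniverse.hodge hHD hA 1` ("independently of `𝔞`": for every realisation).
[cite: GreenGriffithsKerr2012, §V.B] [cite: Deligne1982HodgeCycles, Example 3.7 and §5]
[cite: Shimura1998, §6.2 Theorem 3] -/
theorem exists_ofCMType_eq_comapEquiv (h : IsCMTypeRealisation Φ A ι θ) (hHD : exists_isReal_hodgeModel)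
    (hI : hodgePQ_independent_of_hodgeModel) :
    ∃ e : K ≃ₗ[ℚ] bettiCohomology A.X 1,
      (∀ k x, e (k * x) = cmAction θ h.isInducedOnIntegers k (e x)) ∧
      ofCMType Φ = (BettiUniverse.hodge hHD h.1 1).comapEquiv e := by
  haveI : Module.Finite ℚ (bettiCohomology A.X 1) := BettiUniverse.finite h.1 1
  obtain ⟨e, he⟩ := exists_equivariant_equiv (cmAction θ h.isInducedOnIntegers)
    (BettiUniverse.finrank_bettiCohomology_one_eq h.1 h.2.1)
  exact ⟨e, he, ofCMType_eq_comapEquiv h hHD hI e he⟩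

/-- The intertwining in `EndAction` form: `e` intertwines the regular action `endActionOfCMType Φ` (multiplication)
with the rational CM action `cmEndAction θ hθ hHD hI hA`. [cite: GreenGriffithsKerr2012, §V.C] -/
theorem endAction_intertwine (h : IsCMTypeRealisation Φ A ι θ) (hHD : exists_isReal_hodgeModel)
    (hI : hodgePQ_independent_of_hodgeModel) (e : K ≃ₗ[ℚ] bettiCohomology A.X 1)
    (he : ∀ k x, e (k * x) = cmAction θ h.isInducedOnIntegers k (e x)) (k : K) :
    e.toLinearMap ∘ₗ (endActionOfCMType Φ).ι k =
      (cmEndAction θ h.isInducedOnIntegers hHD hI h.1).ι k ∘ₗ e.toLinearMap :=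
  LinearMap.ext fun x => by simpa [HodgeStructure.endActionOfCMType_ι] using he k x

end Rigidity

/-! ### Mumford–Tate groups, Hodge groups and Mumford–Tate rank: conjugate / equal -/

section MumfordTate

variable {K : Type} [Field K] [NumberField K] {Φ : CMType K} {A : AbelianVariety ℂ} {ι : 𝓞 K →+* End A}
  {θ : K →+* Module.End ℂ (complexBetti A.X 1)}
  [Literature.AlgebraicGeometry.Motives.HodgeTensorFacts.{0, 0}] [Module.Finite ℚ (bettiCohomology A.X 1)]

/-- **`MT(V¹_{(K,Φ)}) = e⁻¹ MT(H¹(A)) e`**: for every `K`-equivariant `ℚ`-isomorphism `e : K ≃ H¹(A(ℂ); ℚ)`,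
`g ∈ MT(ofCMType Φ) ↔ e g e⁻¹ ∈ MT(H¹(A(ℂ); ℚ))` (the tree's `ℚ`-points Mumford–Tate group
`HodgeStructure.mumfordTateGroup`; `Module.Finite ℚ (bettiCohomology A.X 1)` is `BettiUniverse.finite`,
`HodgeTensorFacts` is `hodgeTensorFacts_holds`). [cite: Deligne1982HodgeCycles, Example 3.7 and I Prop. 3.4]
[cite: GreenGriffithsKerr2012, §V.B] -/
theorem mem_mumfordTateGroup_ofCMType_iff (h : IsCMTypeRealisation Φ A ι θ) (hHD : exists_isReal_hodgeModel)
    (hI : hodgePQ_independent_of_hodgeModel) (e : K ≃ₗ[ℚ] bettiCohomology A.X 1)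
    (he : ∀ k x, e (k * x) = cmAction θ h.isInducedOnIntegers k (e x)) (g : K ≃ₗ[ℚ] K) :
    g ∈ (ofCMType Φ).mumfordTateGroup ↔
      e.symm.trans (g.trans e) ∈ (BettiUniverse.hodge hHD h.1 1).mumfordTateGroup := by
  rw [ofCMType_eq_comapEquiv h hHD hI e he]
  exact HodgeStructure.mem_mumfordTateGroup_comapEquiv_iff _ e g

/-- **`Hg(V¹_{(K,Φ)}) = e⁻¹ Hg(H¹(A)) e`**: the same for the Hodge groups (`HodgeStructure.hodgeGroup`).
[cite: Deligne1982HodgeCycles, Example 3.7 and I Prop. 3.4] [cite: GreenGriffithsKerr2012, §V.B] -/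
theorem mem_hodgeGroup_ofCMType_iff (h : IsCMTypeRealisation Φ A ι θ) (hHD : exists_isReal_hodgeModel)
    (hI : hodgePQ_independent_of_hodgeModel) (e : K ≃ₗ[ℚ] bettiCohomology A.X 1)
    (he : ∀ k x, e (k * x) = cmAction θ h.isInducedOnIntegers k (e x)) (g : K ≃ₗ[ℚ] K) :
    g ∈ (ofCMType Φ).hodgeGroup ↔ e.symm.trans (g.trans e) ∈ (BettiUniverse.hodge hHD h.1 1).hodgeGroup := by
  rw [ofCMType_eq_comapEquiv h hHD hI e he]
  exact HodgeStructure.mem_hodgeGroup_comapEquiv_iff _ e g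

/-- Read from `H¹(A)`: `g′ ∈ MT(H¹(A(ℂ); ℚ)) ↔ e⁻¹ g′ e ∈ MT(ofCMType Φ)` — the Mumford–Tate group of a CM abelian
variety is (conjugate to) that of its CM-type Hodge structure. [cite: Deligne1982HodgeCycles, Example 3.7 and I Prop. 3.4] -/
theorem mem_mumfordTateGroup_hodge_iff (h : IsCMTypeRealisation Φ A ι θ) (hHD : exists_isReal_hodgeModel)
    (hI : hodgePQ_independent_of_hodgeModel) (e : K ≃ₗ[ℚ] bettiCohomology A.X 1)
    (he : ∀ k x, e (k * x) = cmAction θ h.isInducedOnIntegers k (e x))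
    (g' : bettiCohomology A.X 1 ≃ₗ[ℚ] bettiCohomology A.X 1) :
    g' ∈ (BettiUniverse.hodge hHD h.1 1).mumfordTateGroup ↔
      e.trans (g'.trans e.symm) ∈ (ofCMType Φ).mumfordTateGroup := by
  rw [ofCMType_eq_comapEquiv h hHD hI e he]
  exact HodgeStructure.mem_mumfordTateGroup_iff_comapEquiv _ e g'

/-- **`𝔪𝔱(V¹_{(K,Φ)}) = e⁻¹ 𝔪𝔱(H¹(A)) e`** for the Mumford–Tate Lie algebras
(`HodgeStructure.mumfordTateLieAlgebra_comapEquiv`). [cite: Deligne1982HodgeCycles, Example 3.7 and I §3] -/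
theorem mumfordTateLieAlgebra_ofCMType_eq (h : IsCMTypeRealisation Φ A ι θ) (hHD : exists_isReal_hodgeModel)
    (hI : hodgePQ_independent_of_hodgeModel) (e : K ≃ₗ[ℚ] bettiCohomology A.X 1)
    (he : ∀ k x, e (k * x) = cmAction θ h.isInducedOnIntegers k (e x)) :
    (ofCMType Φ).mumfordTateLieAlgebra =
      (BettiUniverse.hodge hHD h.1 1).mumfordTateLieAlgebra.comap
        (e.conj : Module.End ℚ K →ₗ[ℚ] Module.End ℚ (bettiCohomology A.X 1)) := by
  rw [ofCMType_eq_comapEquiv h hHD hI e he]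
  exact HodgeStructure.mumfordTateLieAlgebra_comapEquiv _ e

/-- **`rk MT(V¹_{(K,Φ)}) = rk MT(H¹(A(ℂ); ℚ))`**: the Mumford–Tate ranks (`HodgeStructure.mtRank`, the dimension
of the Mumford–Tate Lie algebra) of the CM-type Hodge structure and of `H¹` of any realisation agree
(`HodgeStructure.mtRank_comapEquiv`). [cite: Deligne1982HodgeCycles, Example 3.7 and I §3]
[cite: GreenGriffithsKerr2012, §V.B] -/
theorem mtRank_ofCMType_eq (h : IsCMTypeRealisation Φ A ι θ) (hHD : exists_isReal_hodgeModel)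
    (hI : hodgePQ_independent_of_hodgeModel) :
    (ofCMType Φ).mtRank = (BettiUniverse.hodge hHD h.1 1).mtRank := by
  obtain ⟨e, he, hH⟩ := exists_ofCMType_eq_comapEquiv h hHD hI
  rw [hH]
  exact HodgeStructure.mtRank_comapEquiv _ e

end MumfordTate

end CMBettiModel

end Literature.AlgebraicGeometry.HodgeTheory

end
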